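import Mathlib
import HarnessLib

/-!
# Stub `stub_mourreThresholdLAP` — Mourre LAP infrastructure 16: compactly supported cutoffs factor through the resolvent variables

Item `stmt-AtomisticToContinuum-12594` (crux `MourreDissolution` of route `EmbeddedDrudeMourre`,
sub-problem `FouriersLaw`), line `separable-vertex-faddeev-pair-sector`, stub S6
`stub_mourreThresholdLAP` (Mourre's limiting absorption principle; NOT in the tree). Fifth step of
L3 of the proof map (ABG Thm 6.2.5 by route (b)), PURE REAL ANALYSIS: a smooth compactly supported
`φ : ℝ → ℂ` is written as a product of smooth compactly supported functions of the two bounded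
"resolvent variables" `t = 1/(1 + (x-c)²)` and `s = (x-c)/(1 + (x-c)²)` (the symbols of
`R(c+i)R(c-i)` and `½(R(c+i) + R(c-i))`):

  `φ(x) = Φ₁(1/(1 + (x-c)²)) · Χ((x-c)/(1 + (x-c)²))`   for ALL real `x`,

with the shift `c` chosen to the left of `supp φ` (so that `t` is injective there; no square-root
singularity is met: `Φ₁(u) = φ(c + √(1/u - 1))` is smooth because `φ` vanishes near the two ends
`u ↓ 0`, `u ↑ 1`) and `Χ` a bump equal to `1` on the positive `s`-range of the support and to `0` on
`s ≤ 0` (killing the mirror branch `x ↦ 2c - x`). Headline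
`compactlySupported_factorsThrough_resolventVariables`. No operators appear in this file.
-/

noncomputable section

open Filter Topology Set Metric

namespace Summit.AtomisticToContinuum.FouriersLaw.Theorems.MourreDissolution

/-! ## §1. The radial profile `Φ₁(u) = φ(c + √(1/u - 1))` -/

/-- The radial profile of `φ` seen through `t = 1/(1 + (x - c)²)`: `profile φ c u = φ(c + √(1/u - 1))`
(`√` is Mathlib's `Real.sqrt`, `= 0` on non-positive arguments, so the profile is `φ(c)` for
`u ∉ (0, 1)`). [folklore] -/
def profile (φ : ℝ → ℂ) (c u : ℝ) : ℂ := φ (c + Real.sqrt (1 / u - 1))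

/-- On the `t`-variable of a point right of `c` the profile returns `φ`:
`profile φ c (1/(1 + y²)) = φ(c + y)` for `y ≥ 0`. [folklore] -/
theorem profile_tVar (φ : ℝ → ℂ) (c : ℝ) {y : ℝ} (hy : 0 ≤ y) :
    profile φ c (1 / (1 + y ^ 2)) = φ (c + y) := by
  have h : 1 / (1 / (1 + y ^ 2)) - 1 = y ^ 2 := by
    have : (0 : ℝ) < 1 + y ^ 2 := by positivity
    field_simp
    ring
  rw [profile, h, Real.sqrt_sq hy]

/-- The profile vanishes for `u > 1/2` when `φ` vanishes on `(-∞, c + 1)`. [folklore] -/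
theorem profile_eq_zero_of_half_lt {φ : ℝ → ℂ} {c : ℝ} (h1 : ∀ r, r < 1 → φ (c + r) = 0) {u : ℝ}
    (hu : 1 / 2 < u) : profile φ c u = 0 := by
  refine h1 _ ?_
  have hu0 : 0 < u := by linarith
  have hlt : 1 / u - 1 < 1 := by
    have : 1 / u < 2 := by rw [div_lt_iff₀ hu0]; linarith
    linarith
  rcases le_or_gt (1 / u - 1) 0 with h | h
  · rw [Real.sqrt_eq_zero'.2 h]; exact one_pos
  · calc Real.sqrt (1 / u - 1) < Real.sqrt 1 := Real.sqrt_lt_sqrt h.le hlt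
      _ = 1 := Real.sqrt_one

/-- The profile vanishes for `u < 1/(1 + b²)` when `φ` vanishes on `(-∞, c + 1) ∪ (c + b, ∞)`.
[folklore] -/
theorem profile_eq_zero_of_lt {φ : ℝ → ℂ} {c b : ℝ} (hb : 0 < b) (h1 : ∀ r, r < 1 → φ (c + r) = 0)
    (h2 : ∀ r, b < r → φ (c + r) = 0) {u : ℝ} (hu : u < 1 / (1 + b ^ 2)) : profile φ c u = 0 := by
  rcases le_or_gt u 0 with hu0 | hu0
  · refine h1 _ ?_
    have : 1 / u - 1 ≤ 0 := by
      have : 1 / u ≤ 0 := div_nonpos_of_nonneg_of_nonpos zero_le_one hu0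
      linarith
    rw [Real.sqrt_eq_zero'.2 this]
    exact one_pos
  · refine h2 _ ?_
    have hb2 : b ^ 2 < 1 / u - 1 := by
      have h' : 1 + b ^ 2 < 1 / u := by
        rw [lt_div_iff₀ hu0]
        have := (lt_div_iff₀ (by positivity : (0 : ℝ) < 1 + b ^ 2)).1 hu
        linarith
      linarith
    calc b = Real.sqrt (b ^ 2) := (Real.sqrt_sq hb.le).symm
      _ < Real.sqrt (1 / u - 1) := Real.sqrt_lt_sqrt (sq_nonneg _) hb2

/-- **The profile is smooth**: on `(0, 1)` it is a composition of smooth maps (`√` away from `0`),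
and near every point of `(-∞, 1/(1+b²)) ∪ (1/2, ∞) ⊇ ℝ ∖ (0, 1)` it vanishes identically. [folklore] -/
theorem contDiff_profile {φ : ℝ → ℂ} (hφ : ContDiff ℝ ((⊤ : ℕ∞) : WithTop ℕ∞) φ) {c b : ℝ}
    (hb : 0 < b) (h1 : ∀ r, r < 1 → φ (c + r) = 0) (h2 : ∀ r, b < r → φ (c + r) = 0) :
    ContDiff ℝ ((⊤ : ℕ∞) : WithTop ℕ∞) (profile φ c) := by
  refine contDiff_iff_contDiffAt.2 fun u => ?_
  by_cases hu : 0 < u ∧ u < 1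
  · -- smooth composition on `(0, 1)`
    have hne : 1 / u - 1 ≠ 0 := by
      have : 1 < 1 / u := by rw [lt_div_iff₀ hu.1]; linarith
      linarith
    have h_inner : ContDiffAt ℝ ((⊤ : ℕ∞) : WithTop ℕ∞) (fun w : ℝ => 1 / w - 1) u :=
      ((contDiffAt_const.div contDiffAt_id hu.1.ne').sub contDiffAt_const)
    have h_sqrt : ContDiffAt ℝ ((⊤ : ℕ∞) : WithTop ℕ∞) (fun w : ℝ => Real.sqrt (1 / w - 1)) u :=
      (Real.contDiffAt_sqrt hne).comp u h_inner
    exact hφ.contDiffAt.comp u (contDiffAt_const.add h_sqrt)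
  · -- locally zero elsewhere
    have hzero : profile φ c =ᶠ[𝓝 u] fun _ => 0 := by
      rcases not_and_or.1 hu with hu0 | hu1
      · have hu0' : u < 1 / (1 + b ^ 2) := (not_lt.1 hu0).trans_lt (by positivity)
        filter_upwards [Iio_mem_nhds hu0'] with w hw
        exact profile_eq_zero_of_lt hb h1 h2 hw
      · have hu1' : 1 / 2 < u := by linarith [not_lt.1 hu1]
        filter_upwards [Ioi_mem_nhds hu1'] with w hw
        exact profile_eq_zero_of_half_lt h1 hw
    exact (contDiffAt_const (c := (0 : ℂ))).congr_of_eventuallyEq hzero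

/-- **The profile has compact support** `⊆ [1/(1+b²), 1/2]`. [folklore] -/
theorem hasCompactSupport_profile {φ : ℝ → ℂ} {c b : ℝ} (hb : 0 < b)
    (h1 : ∀ r, r < 1 → φ (c + r) = 0) (h2 : ∀ r, b < r → φ (c + r) = 0) :
    HasCompactSupport (profile φ c) := by
  refine HasCompactSupport.intro (isCompact_Icc (a := 1 / (1 + b ^ 2)) (b := 1 / 2)) fun u hu => ?_
  rw [mem_Icc, not_and_or, not_le, not_le] at hu
  rcases hu with hu | hu
  · exact profile_eq_zero_of_lt hb h1 h2 hu
  · exact profile_eq_zero_of_half_lt h1 hu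

/-! ## §2. The angular bump `Χ` on the `s`-variable -/

/-- `b/(1 + b²) ≤ 2/5` for `b ≥ 2` (the `s`-value at the right end of the support). [folklore] -/
theorem div_one_add_sq_le {b : ℝ} (hb : 2 ≤ b) : b / (1 + b ^ 2) ≤ 2 / 5 := by
  rw [div_le_div_iff₀ (by positivity) (by norm_num)]
  nlinarith

/-- **The angular bump**: a smooth bump around `1/2` equal to `1` on `[b/(1+b²), 1 - b/(1+b²)]` and
supported in `(b/(2(1+b²)), 1 - b/(2(1+b²)))` (so vanishing on `s ≤ 0`). [folklore] -/
def angularBump {b : ℝ} (hb : 2 ≤ b) : ContDiffBump (1 / 2 : ℝ) where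
  rIn := 1 / 2 - b / (1 + b ^ 2)
  rOut := 1 / 2 - b / (2 * (1 + b ^ 2))
  rIn_pos := by have := div_one_add_sq_le hb; linarith
  rIn_lt_rOut := by
    have : 0 < b / (1 + b ^ 2) := by positivity
    have e : b / (2 * (1 + b ^ 2)) = b / (1 + b ^ 2) / 2 := by
      rw [div_div, mul_comm]
    rw [e]; linarith

/-- The angular bump is `1` on the `s`-range `[b/(1+b²), 1/2]` of the support. [folklore] -/
theorem angularBump_eq_one {b : ℝ} (hb : 2 ≤ b) {w : ℝ} (hw1 : b / (1 + b ^ 2) ≤ w) (hw2 : w ≤ 1 / 2) :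
    (angularBump hb) w = 1 := by
  refine (angularBump hb).one_of_mem_closedBall ?_
  rw [mem_closedBall, Real.dist_eq, abs_le]
  change -(1 / 2 - b / (1 + b ^ 2)) ≤ w - 1 / 2 ∧ w - 1 / 2 ≤ 1 / 2 - b / (1 + b ^ 2)
  have : 0 < b / (1 + b ^ 2) := by positivity
  constructor <;> linarith

/-- The angular bump vanishes on `w ≤ 0`. [folklore] -/
theorem angularBump_eq_zero {b : ℝ} (hb : 2 ≤ b) {w : ℝ} (hw : w ≤ 0) : (angularBump hb) w = 0 := by
  refine (angularBump hb).zero_of_le_dist ?_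
  rw [Real.dist_eq]
  change 1 / 2 - b / (2 * (1 + b ^ 2)) ≤ |w - 1 / 2|
  have : 0 < b / (2 * (1 + b ^ 2)) := by positivity
  have h : 1 / 2 - w ≤ |w - 1 / 2| := by rw [abs_sub_comm]; exact le_abs_self _
  linarith

/-- `s(y) = y/(1+y²)` is at most `1/2`. [folklore] -/
theorem sVar_le_half (y : ℝ) : y / (1 + y ^ 2) ≤ 1 / 2 := by
  rw [div_le_div_iff₀ (by positivity) (by norm_num)]
  nlinarith [sq_nonneg (y - 1)]

/-- `s` is decreasing on `[1, ∞)`: `b/(1+b²) ≤ y/(1+y²)` for `1 ≤ y ≤ b`. [folklore] -/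
theorem sVar_ge_of_le {y b : ℝ} (hy : 1 ≤ y) (hyb : y ≤ b) : b / (1 + b ^ 2) ≤ y / (1 + y ^ 2) := by
  rw [div_le_div_iff₀ (by positivity) (by positivity)]
  nlinarith [mul_nonneg (sub_nonneg.2 hyb) (by nlinarith : (0 : ℝ) ≤ y * b - 1)]

/-! ## §3. The factorisation -/

/-- **Pointwise factorisation through the resolvent variables**: if `φ` is supported in
`[c + 1, c + b]` (`b ≥ 2`), then for ALL real `x`,
`φ(x) = Φ₁(1/(1+(x-c)²)) · Χ((x-c)/(1+(x-c)²))` with `Φ₁ = profile φ c`, `Χ = angularBump`. [folklore] -/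
theorem cutoff_factorisation {φ : ℝ → ℂ} {c b : ℝ} (hb : 2 ≤ b)
    (hsupp : ∀ x, φ x ≠ 0 → c + 1 ≤ x ∧ x ≤ c + b) (x : ℝ) :
    φ x = profile φ c (1 / (1 + (x - c) ^ 2)) *
      (((angularBump hb) ((x - c) / (1 + (x - c) ^ 2)) : ℝ) : ℂ) := by
  set y := x - c with hy
  have hx : x = c + y := by rw [hy]; ring
  by_cases hφ : φ x = 0
  · -- both sides vanish
    rw [hφ]
    rcases le_or_gt 0 y with h0 | h0
    · rw [profile_tVar φ c h0, ← hx, hφ, zero_mul]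
    · have hs : y / (1 + y ^ 2) ≤ 0 := div_nonpos_of_nonpos_of_nonneg h0.le (by positivity)
      rw [angularBump_eq_zero hb hs]
      simp
  · obtain ⟨h1, h2⟩ := hsupp x hφ
    have hy1 : 1 ≤ y := by linarith
    have hyb : y ≤ b := by linarith
    rw [profile_tVar φ c (by linarith), ← hx,
      angularBump_eq_one hb (sVar_ge_of_le hy1 hyb) (sVar_le_half y)]
    simp

/-- Support control in the radial parametrisation: `φ(c + r) = 0` for `r < 1` and for `r > b`.
[folklore] -/
theorem support_radial {φ : ℝ → ℂ} {c b : ℝ} (hsupp : ∀ x, φ x ≠ 0 → c + 1 ≤ x ∧ x ≤ c + b) :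
    (∀ r, r < 1 → φ (c + r) = 0) ∧ (∀ r, b < r → φ (c + r) = 0) := by
  constructor
  · intro r hr
    by_contra h
    have := (hsupp _ h).1
    linarith
  · intro r hr
    by_contra h
    have := (hsupp _ h).2
    linarith

/-! ## §4. Headline (registered helper stub) -/

/-- **Compactly supported smooth functions factor through the resolvent variables, headline form**
(all binders explicit; registered helper stub of `stub_mourreThresholdLAP`): for every smooth
compactly supported `φ : ℝ → ℂ` there are a shift `c` and smooth compactly supported `Φ₁, Χ` with
`φ(x) = Φ₁(1/(1 + (x-c)²)) · Χ((x-c)/(1 + (x-c)²))` for all real `x`. [folklore] -/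
theorem compactlySupported_factorsThrough_resolventVariables :
    ∀ (φ : ℝ → ℂ), ContDiff ℝ ((⊤ : ℕ∞) : WithTop ℕ∞) φ → HasCompactSupport φ →
      ∃ (c : ℝ) (Φ₁ Χ : ℝ → ℂ), ContDiff ℝ ((⊤ : ℕ∞) : WithTop ℕ∞) Φ₁ ∧ HasCompactSupport Φ₁ ∧
        ContDiff ℝ ((⊤ : ℕ∞) : WithTop ℕ∞) Χ ∧ HasCompactSupport Χ ∧
          ∀ x : ℝ, φ x = Φ₁ (1 / (1 + (x - c) ^ 2)) * Χ ((x - c) / (1 + (x - c) ^ 2)) := by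
  intro φ hφ hK
  -- the support lies in a ball `[-R, R]`
  obtain ⟨R, hR⟩ := (Metric.isBounded_iff_subset_closedBall (0 : ℝ)).1 hK.isCompact.isBounded
  set R' : ℝ := max R 0 with hR'
  set c : ℝ := -R' - 1 with hc
  set b : ℝ := max (2 * R' + 1) 2 with hbdef
  have hb : 2 ≤ b := le_max_right _ _
  have hsupp : ∀ x, φ x ≠ 0 → c + 1 ≤ x ∧ x ≤ c + b := by
    intro x hx
    have hxK : x ∈ closedBall (0 : ℝ) R := hR (subset_tsupport _ (Function.mem_support.2 hx))
    rw [mem_closedBall, Real.dist_eq, sub_zero, abs_le] at hxK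
    have hRR' : R ≤ R' := le_max_left _ _
    have h2 : 2 * R' + 1 ≤ b := le_max_left _ _
    constructor <;> [skip; skip] <;> linarith [hxK.1, hxK.2]
  obtain ⟨h1, h2⟩ := support_radial hsupp
  have hb0 : 0 < b := by linarith
  refine ⟨c, profile φ c, fun w => (((angularBump hb) w : ℝ) : ℂ), contDiff_profile hφ hb0 h1 h2,
    hasCompactSupport_profile hb0 h1 h2, ?_, ?_, fun x => cutoff_factorisation hb hsupp x⟩
  · exact Complex.ofRealCLM.contDiff.comp (angularBump hb).contDiff
  · exact (angularBump hb).hasCompactSupport.comp_left Complex.ofReal_zero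

end Summit.AtomisticToContinuum.FouriersLaw.Theorems.MourreDissolution
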